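import Summits.QuantumFields.YangMills.Theorems.AllWindowsColdBoxBoxHighLineBoxToChartRelativeSup
import Summits.QuantumFields.YangMills.Theorems.AllWindowsColdBoxBoxHighLineSmallFieldInsideFPSharp

/-!
# Steps A+B+C at the U5 window in relative form — UNCONDITIONAL (T-S5.6′ ✓ by w4 g29's `SmallFieldFPSharp.smallFieldInsideFP_sharp`)

Width seat `ym-line-sfw-p2-w2` (prover-ym-line-sfw-p2-w2-g32-0).  The «`…_relative_strong`» deliverable of planner ym-idea-2 g18's `ASSEMBLY-U5.md` v0 §2 (Steps A–C
of the future U5 assembly `landauThirdOrder_of`, LINE-20 ⟨stmt-QuantumFields-24336⟩; U5 prep, helper — U5 UNSTAFFED, I23 open): ✓`BoxToChart.boxPlaqCov_sub_chartCov_relative_sup`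
(U2 + T-S5.4J∞ + 6a′, hypothesis `h6` = the typed body of `SmallFieldInsideFPSharp`) with `h6` DISCHARGED BY NAME by ✓T-S5.6′
`SmallFieldFPSharp.smallFieldInsideFP_sharp` (w4 g29, p749951 — statement token-for-token the Prop of `TaskU5L5.lean`).

★★★ **`BoxToChart.boxPlaqCov_sub_chartCov_relative_sup'`** — for `0 < θ`, `θ/2 < κ₃ < ε₁`, `2θ < ε₁ < 1/2 − 3θ`, `5θ + ε₁ − 1/2 < 2κ₃` (feasible iff
`θ < 1/10`, ✓`exists_exponents_sup`):  `∃ K M L β₀, ∀ β ≥ β₀, ∀ T (L ≤ T, M·T ≤ H), |β²·boxPlaqCov β H T − β²·(⟨c₀c_T⟩_D − ⟨c₀⟩_D⟨c_T⟩_D)| ≤ (1/8)·((3/4)·boxDirCircSqCov H T)`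
with `H = ⌈β^θ⌉₊`, `s = β^{κ₃−1/2}`, `spl = β^{ε₁−1/2}`, `r = K·H·(1+log H)·spl + 2·(H²(1+log β)²/√β)` — the hypothesis `hAC` (with `ε₁ = 1/8`) of
✓`landauRelativeComparisonBulk_of_split` at every `θ < 1/10`.

Everything proved; no definitions; tree only; standard axioms.  HONEST LABEL: Steps A–C bookkeeping only; Steps D–E at third order (L2/L3c/κ₅ sizes, cubic cut, budget,
final bookkeeping) are OPEN and others'; S5 untouched; U5, ⟨24336⟩, ⟨24004⟩ remain OPEN; no stub is closed by name; no crux, rung or summit is proved;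
**the Yang–Mills mass gap is NOT proved by this file; no summit is proved by a line.**
-/

set_option autoImplicit false

noncomputable section

open MeasureTheory Real
open Literature.Probability.LatticeModels (Site)
open Literature.MathematicalPhysics.QuantumLattice (LGConfig fundamentalRep)
open Summit.QuantumFields.YangMills.Theorems.WeakCouplingRates (boxState boxCentre boxPlaqCov boxDirCircSqCov)

namespace Summit.QuantumFields.YangMills.Theorems.AllWindowsColdBoxBoxHighLine

namespace BoxToChart

/-- ★★★ **Steps A+B+C at the U5 window, relative form, UNCONDITIONAL** (✓`boxPlaqCov_sub_chartCov_relative_sup` fed with ✓T-S5.6′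
`SmallFieldFPSharp.smallFieldInsideFP_sharp`). -/
theorem boxPlaqCov_sub_chartCov_relative_sup' {θ κ₃ ε₁ : ℝ} (hθ : 0 < θ) (hκl : θ / 2 < κ₃) (hε₁l : κ₃ < ε₁) (hε₁θ : 2 * θ < ε₁)
    (hε₁u : ε₁ < 1 / 2 - 3 * θ) (hε₁u' : 5 * θ + ε₁ - 1 / 2 < 2 * κ₃) :
    ∃ K M L : ℝ, 0 < K ∧ 1 ≤ M ∧ 1 ≤ L ∧ ∃ β₀ : ℝ, 1 ≤ β₀ ∧ ∀ β : ℝ, β₀ ≤ β → ∀ T : ℕ, L ≤ (T : ℝ) → M * (T : ℝ) ≤ (⌈β ^ θ⌉₊ : ℝ) →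
      ∀ (H : ℕ) (s spl r : ℝ), H = ⌈β ^ θ⌉₊ → s = β ^ (κ₃ - 1 / 2) → spl = β ^ (ε₁ - 1 / 2) →
        r = K * H * (1 + Real.log H) * spl + 2 * ((H : ℝ) ^ 2 * (1 + Real.log β) ^ 2 / Real.sqrt β) →
      |β ^ 2 * boxPlaqCov (fundamentalRep (Fin 2)) β H T -
          β ^ 2 * ((∫ a in smallField H s, chartPlaqCost H (boxCentre H) 1 2 a * chartPlaqCost H (boxCentre H + Pi.single 0 (T : ℤ)) 1 2 a *
                fpChartWeight β H r a) / (∫ a in smallField H s, fpChartWeight β H r a) -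
            (∫ a in smallField H s, chartPlaqCost H (boxCentre H) 1 2 a * fpChartWeight β H r a) /
                (∫ a in smallField H s, fpChartWeight β H r a) *
              ((∫ a in smallField H s, chartPlaqCost H (boxCentre H + Pi.single 0 (T : ℤ)) 1 2 a * fpChartWeight β H r a) /
                (∫ a in smallField H s, fpChartWeight β H r a)))| ≤
        1 / 8 * (3 / 4 * boxDirCircSqCov H T) :=
  boxPlaqCov_sub_chartCov_relative_sup SmallFieldFPSharp.smallFieldInsideFP_sharp hθ hκl hε₁l hε₁θ hε₁u hε₁u'

end BoxToChart

end Summit.QuantumFields.YangMills.Theorems.AllWindowsColdBoxBoxHighLine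

end
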